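import Literature.NumberTheory.IwasawaTheory.Greenberg2006.CorankEulerCharacteristicInduction
import Literature.NumberTheory.IwasawaTheory.Greenberg2006.CohomologyCofiniteGenerationAssembly
import Literature.NumberTheory.GaloisRepresentations.ContinuousCohomologyCorankModPrime
import HarnessLib

/-!
# Greenberg 2006, Props. 4.1 / 4.2: the ONE-PRIME SPECIALISATION STEP of the corank formula, for an
# arbitrary compact group, from the cohomological engine

Topic `NumberTheory/IwasawaTheory/Greenberg2006`; namespace
`Literature.NumberTheory.IwasawaTheory.Greenberg2006`.  THEOREMS ONLY (no definition, no named
fact, no `sorry`, no instance).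

The induction shell `corankEuler_of_step_of_finiteEuler` (`CorankEulerCharacteristicInduction.lean`)
derives the Euler–Poincaré `Λ`-corank formula (Greenberg, *On the structure of certain Galois
cohomology groups* (2006), Props. 4.1/4.2, proof p. 368) from its hypothesis schema `hstep` — the
one-prime specialisation step.  This file DISCHARGES `hstep` for every compact group `Γ` from
print's two standing inputs, as the theorem **`corankStep_of_finiteCoefficients`**:

* (F) `Hⁿ(Γ, A)` is finite for every finite discrete module `A` killed by `p` and every `n` (§3
  p. 358 L8–13: "This is so if (i) `G = G_{K_v}` … or (ii) `G = Gal(K_Σ/K)`");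
* (V) `H^q(Γ, E) = 0` for `q ≥ 3` and every discrete `p`-primary `E` (`cd_p Γ ≤ 2`: §5 A p. 372
  "the `p`-cohomological dimension of `G_{K_v}` is equal to `2`"; Prop. 4.1: "For `i ≥ 3`, we have
  `Hⁱ(K_Σ/K, 𝒟) = 0` except possibly when `p = 2`").

PROOF of the step at (`Λ ≅ ℤ_p⟦T₁,…,T_j⟧`, `T` a non-zero prime, `D` discrete `p`-primary with
finitely generated dual), following p. 368 L25–52 with the tree's engine
(`ContinuousCohomologyCorankModPrime.lean`): (1) `D₀ = T^k D` is `T`-divisible for `k ≫ 0`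
(`exists_pow_smul_divisible`) and has the same coranks as `D`, in cohomology too ("`D/D_{Λ-div}` is
`Λ`-cotorsion", `finrank_characterModule_H_eq_of_smul_mem`); (2) all duals of cohomology are
finitely generated (Prop. 3.2: `ContinuousRep.module_finite_characterModule_continuousCohomology`
with `I = 𝔪_Λ ∋ p` and (F)); (3) `0 → D₀[T] → D₀ →(T·) D₀ → 0` is a short exact sequence of
discrete `Γ`-modules and `H³(Γ, D₀[T]) = 0` by (V), so
`Σ_{i≤2}(−1)ⁱ rank_{Λ/T} Hⁱ(Γ, D₀[T])^∨ = Σ_{i≤2}(−1)ⁱ rank_Λ Hⁱ(Γ, D₀)^∨`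
(`alternatingSum_finrank_torsionBy_characterModule_H_eq`); (4) `D' := D₀[T]` "considered as a
module over `(Λ/P)`" is a continuous `(Λ/T)`-representation with the same cohomology ranks
(`finrank_characterModule_H_quotientRing_eq`) and `rank_{Λ/T} D'^∨ = rank_Λ D₀^∨`
(`finrank_eq_finrank_quotient_sub_finrank_torsionBy`, `D₀^∨[T] = 0`).

## References
* R. Greenberg, *On the structure of certain Galois cohomology groups*, Doc. Math. Extra Vol.
  Coates (2006) 335–391, §4 A (proof of Props. 4.1/4.2, p. 368 L25–52), §3 A (p. 358 L8–13),
  Prop. 3.2. [Greenberg2006]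
-/

noncomputable section

open scoped Classical
open CategoryTheory IsLocalRing
open _root_.Module Submodule
open Literature.NumberTheory.GaloisRepresentations
open Literature.Algebra.Module

namespace Literature.NumberTheory.IwasawaTheory.Greenberg2006

variable {Γ : Type} [Group Γ] [TopologicalSpace Γ] [IsTopologicalGroup Γ] [CompactSpace Γ]
variable (p : ℕ) [Fact p.Prime]

/-! ### §1. The short exact sequence `0 → D[T] → D →(T·) D → 0` of a `T`-divisible module -/

section SES

variable {Λ : Type} [CommRing Λ] [TopologicalSpace Λ]
variable {D : Type} [AddCommGroup D] [Module Λ D] [TopologicalSpace D] [DiscreteTopology D]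
  [ContinuousSMul Λ D]

omit [IsTopologicalGroup Γ] [CompactSpace Γ] [Fact p.Prime] in
/-- For a `T`-DIVISIBLE discrete `Γ`-module `D`, the inclusion of `D[T]` and multiplication by `T`
form a short exact sequence `0 → D[T] → D →(T·) D → 0` of discrete `Γ`-modules (`IsSES`), the
middle map being `T·`. [cite: Greenberg2006, §4 A (proof of Props. 4.1/4.2, p. 368 L38–40)] -/
theorem exists_isSES_torsionBy_smul (ρ : ContinuousRep Γ Λ D) (T : Λ)
    (hdiv : ∀ d : D, ∃ d' : D, T • d' = d) :
    ∃ (ι : (ρ.subrepresentation (torsionBy Λ D T) (ρ.torsionBy_smul_le_comap T)).toTopRep ⟶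
        ρ.toTopRep) (μ : ρ.toTopRep ⟶ ρ.toTopRep), IsSES ι μ ∧ ∀ d : D, μ.hom d = T • d := by
  let ι : (ρ.subrepresentation (torsionBy Λ D T) (ρ.torsionBy_smul_le_comap T)).toTopRep ⟶
      ρ.toTopRep := TopRep.ofHom
    { toLinearMap := (torsionBy Λ D T).subtype
      cont := continuous_subtype_val
      isIntertwining' := fun _ => rfl }
  let μ : ρ.toTopRep ⟶ ρ.toTopRep := TopRep.ofHom
    { toLinearMap := T • (LinearMap.id : D →ₗ[Λ] D)
      cont := continuous_of_discreteTopology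
      isIntertwining' := fun g => by
        ext d
        change T • ρ g d = ρ g (T • d)
        rw [(ρ g).map_smul] }
  refine ⟨ι, μ, ?_, fun _ => rfl⟩
  exact
    { comp_eq_zero := by
        ext w
        change T • (w : D) = 0
        exact (mem_torsionBy_iff T (w : D)).1 w.2
      injective := Subtype.val_injective
      exact_mid := fun y hy => by
        have hy' : T • y = 0 := hy
        exact ⟨⟨y, (mem_torsionBy_iff T y).2 hy'⟩, rfl⟩
      surjective := fun y => by
        obtain ⟨d, hd⟩ := hdiv y
        exact ⟨d, hd⟩ }

end SES

/-! ### §2. The one-prime specialisation step from (F) and (V) -/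

section Step

/-- **The one-prime specialisation step of Greenberg's corank formula** — the hypothesis schema
`hstep` of `corankEuler_of_step_of_finiteEuler`, for an arbitrary compact group `Γ`, from
(F) finiteness of `Hⁿ(Γ, A)` for finite `A` killed by `p` and (V) `H^q(Γ, E) = 0` (`q ≥ 3`) for
discrete `p`-primary `E`.  For `Λ ≅ ℤ_p⟦T₁,…,T_j⟧`, a non-zero prime `T ∈ Λ` and a discrete
`p`-primary `Λ[Γ]`-module `D` with finitely generated dual: `D' = (T^k D)[T]` (`k ≫ 0`) over `Λ/(T)`
has `Σ_{i≤2}(−1)ⁱ rank_Λ Hⁱ(Γ,D)^∨ = Σ_{i≤2}(−1)ⁱ rank_{Λ/T} Hⁱ(Γ,D')^∨` and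
`rank_Λ D^∨ = rank_{Λ/T} D'^∨`. [cite: Greenberg2006, §4 A (proof of Props. 4.1/4.2, p. 368 L25–52)] -/
theorem corankStep_of_finiteCoefficients
    (hFin : ∀ (R : Type) [CommRing R] [TopologicalSpace R] (A : Type) [AddCommGroup A] [Module R A]
      [TopologicalSpace A] [DiscreteTopology A] [ContinuousSMul R A] [Finite A]
      (τ : ContinuousRep Γ R A), (∀ a : A, (p : R) • a = 0) → ∀ n : ℕ, Finite (τ.H n))
    (hVan : ∀ (R : Type) [CommRing R] [TopologicalSpace R] [IsTopologicalRing R] (E : Type)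
      [AddCommGroup E] [Module R E] [TopologicalSpace E] [DiscreteTopology E] [ContinuousSMul R E]
      (τ : ContinuousRep Γ R E), (∀ e : E, ∃ n : ℕ, (p ^ n : ℤ) • e = 0) →
      ∀ q : ℕ, 2 < q → Subsingleton (τ.H q)) :
    ∀ (j : ℕ) (Λ : Type) [CommRing Λ] [TopologicalSpace Λ] [IsTopologicalRing Λ],
      (Λ ≃+* MvPowerSeries (Fin j) ℤ_[p]) → ∀ (T : Λ), T ≠ 0 → Prime T →
      ∀ (D : Type) [AddCommGroup D] [Module Λ D] [TopologicalSpace D] [DiscreteTopology D]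
        [ContinuousSMul Λ D] (ρ : ContinuousRep Γ Λ D),
        (∀ d : D, ∃ n : ℕ, (p ^ n : ℤ) • d = 0) → Module.Finite Λ (CharacterModule D) →
        ∃ (D' : Type) (_ : AddCommGroup D') (_ : Module (Λ ⧸ Ideal.span {T}) D')
          (_ : TopologicalSpace D') (_ : DiscreteTopology D')
          (_ : ContinuousSMul (Λ ⧸ Ideal.span {T}) D') (ρ' : ContinuousRep Γ (Λ ⧸ Ideal.span {T}) D'),
          (∀ d : D', ∃ n : ℕ, (p ^ n : ℤ) • d = 0) ∧
          Module.Finite (Λ ⧸ Ideal.span {T}) (CharacterModule D') ∧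
          ((Module.finrank Λ (CharacterModule (ρ.H 0)) : ℤ) -
              Module.finrank Λ (CharacterModule (ρ.H 1)) +
              Module.finrank Λ (CharacterModule (ρ.H 2)) =
            (Module.finrank (Λ ⧸ Ideal.span {T}) (CharacterModule (ρ'.H 0)) : ℤ) -
              Module.finrank (Λ ⧸ Ideal.span {T}) (CharacterModule (ρ'.H 1)) +
              Module.finrank (Λ ⧸ Ideal.span {T}) (CharacterModule (ρ'.H 2))) ∧
          Module.finrank Λ (CharacterModule D) =
            Module.finrank (Λ ⧸ Ideal.span {T}) (CharacterModule D') := by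
  intro j Λ _ _ _ e T hT0 hT D _ _ _ _ _ ρ hpD hD
  -- ring facts for `Λ ≅ ℤ_p⟦T₁,…,T_j⟧`
  haveI : IsLocalRing Λ := isLocalRing_of_ringEquiv_mvPowerSeries e
  haveI : IsNoetherianRing Λ := isNoetherianRing_of_ringEquiv_mvPowerSeries e
  haveI : IsAdicComplete (maximalIdeal Λ) Λ := isAdicComplete_maximalIdeal_of_ringEquiv_mvPowerSeries e
  haveI : Finite (Λ ⧸ maximalIdeal Λ) := finite_quotient_maximalIdeal_of_ringEquiv_mvPowerSeries e
  haveI : IsDomain (MvPowerSeries (Fin j) ℤ_[p]) := NoZeroDivisors.to_isDomain _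
  haveI : IsDomain Λ :=
    Function.Injective.isDomain (e : Λ →+* MvPowerSeries (Fin j) ℤ_[p]) e.injective
  have hTp : (Ideal.span {T}).IsPrime := (Ideal.span_singleton_prime hT0).mpr hT
  haveI : IsDomain (Λ ⧸ Ideal.span {T}) := (Ideal.Quotient.isDomain_iff_prime _).mpr hTp
  haveI := hD
  -- Greenberg's hypothesis (F) for modules killed by `𝔪_Λ ∋ p`
  have hpm : (p : Λ) ∈ maximalIdeal Λ := natCast_mem_maximalIdeal_of_ringEquiv_mvPowerSeries e
  have hΓ : ∀ (A : Type) [AddCommGroup A] [Module Λ A] [TopologicalSpace A] [DiscreteTopology A]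
      [ContinuousSMul Λ A] [Finite A] (τ : ContinuousRep Γ Λ A),
      (∀ r ∈ maximalIdeal Λ, ∀ a : A, r • a = 0) → ∀ n : ℕ,
        Finite (continuousCohomology n τ.toTopRep) :=
    fun A _ _ _ _ _ _ τ hI n => hFin Λ A τ (fun a => hI _ hpm a) n
  -- cofinite generation of cohomology (Prop. 3.2) for every discrete module with f.g. dual
  have hcof : ∀ {E : Type} [AddCommGroup E] [Module Λ E] [TopologicalSpace E] [DiscreteTopology E]
      [ContinuousSMul Λ E] (τ : ContinuousRep Γ Λ E) [Module.Finite Λ (CharacterModule E)] (n : ℕ),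
      Module.Finite Λ (CharacterModule (τ.H n)) :=
    fun τ _ n => ContinuousRep.module_finite_characterModule_continuousCohomology
      (maximalIdeal Λ) hΓ τ n
  -- (1) `D₀ = T^k D` is `T`-divisible
  obtain ⟨k, hk⟩ := exists_pow_smul_divisible (D := D) T
  set D₀ : Submodule Λ D := LinearMap.range (T ^ k • (LinearMap.id : D →ₗ[Λ] D)) with hD₀def
  have hD₀ : ∀ g, D₀ ≤ D₀.comap (ρ g) := by
    rintro g _ ⟨d, rfl⟩
    refine ⟨ρ g d, ?_⟩
    change T ^ k • ρ g d = ρ g (T ^ k • d)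
    rw [(ρ g).map_smul]
  have hTk : T ^ k ≠ 0 := pow_ne_zero k hT0
  have hquot : ∀ d : D, T ^ k • d ∈ D₀ := fun d => ⟨d, rfl⟩
  let σ := ρ.subrepresentation D₀ hD₀
  haveI : Module.Finite Λ (CharacterModule D₀) :=
    Module.Finite.of_surjective (CharacterModule.dual D₀.subtype)
      (CharacterModule.dual_surjective_of_injective _ D₀.injective_subtype)
  have hdiv : ∀ d : D₀, ∃ d' : D₀, T • d' = d := fun d => by
    obtain ⟨z, hz, hzd⟩ := hk d d.2
    exact ⟨⟨z, hz⟩, Subtype.ext hzd⟩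
  have hpD₀ : ∀ d : D₀, ∃ n : ℕ, (p ^ n : ℤ) • d = 0 := fun d => by
    obtain ⟨n, hn⟩ := hpD d
    exact ⟨n, Subtype.ext (by rw [Submodule.coe_smul_of_tower, hn]; rfl)⟩
  -- coranks of `D` and of its cohomology are those of `D₀`
  have hrkD : Module.finrank Λ (CharacterModule D) = Module.finrank Λ (CharacterModule D₀) :=
    finrank_characterModule_eq_of_smul_mem D₀ hTk hquot
  have hrkH : ∀ n : ℕ, Module.finrank Λ (CharacterModule (ρ.H n)) =
      Module.finrank Λ (CharacterModule (σ.H n)) := fun n => by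
    haveI := hcof ρ n
    haveI := hcof σ n
    exact finrank_characterModule_H_eq_of_smul_mem ρ D₀ hD₀ hTk hquot n
  -- (3) the short exact sequence `0 → D₀[T] → D₀ →(T·) D₀ → 0` and the engine
  set A : Submodule Λ D₀ := torsionBy Λ D₀ T with hAdef
  let σA := σ.subrepresentation A (σ.torsionBy_smul_le_comap T)
  obtain ⟨ι, μ, hSES, hμ⟩ := exists_isSES_torsionBy_smul σ T hdiv
  have hA : ∀ a : A, T • a = 0 := fun a => (mem_torsionBy_iff T (a : D₀)).1 a.2 |> fun h =>
    Subtype.ext (by rw [Submodule.coe_smul, h]; rfl)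
  have hpA : ∀ a : A, ∃ n : ℕ, (p ^ n : ℤ) • a = 0 := fun a => by
    obtain ⟨n, hn⟩ := hpD₀ a
    exact ⟨n, Subtype.ext (by rw [Submodule.coe_smul_of_tower, hn]; rfl)⟩
  have h3 : Subsingleton (σA.H 3) := hVan Λ A σA hpA 3 (by norm_num)
  haveI : Module.Finite Λ (CharacterModule A) :=
    Module.Finite.of_surjective (CharacterModule.dual A.subtype)
      (CharacterModule.dual_surjective_of_injective _ A.injective_subtype)
  have hfinσ : ∀ n, Module.Finite Λ (CharacterModule (σ.H n)) := fun n => hcof σ n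
  have hfinA : ∀ n, Module.Finite Λ (CharacterModule (σA.H n)) := fun n => hcof σA n
  have hengine := alternatingSum_finrank_torsionBy_characterModule_H_eq hT0 hTp σA σ hSES hμ hA h3
    hfinσ hfinA
  -- (4) `D' = D₀[T]` as a `(Λ/T)`-representation
  haveI : ContinuousSMul (Λ ⧸ Ideal.span {T}) A :=
    continuousSMul_quotient_of_discreteTopology (Ideal.span {T})
  obtain ⟨τA, hτA⟩ := exists_continuousRep_quotientRing (Ideal.span {T}) σA
  have hH : ∀ n : ℕ, Module.finrank (Λ ⧸ Ideal.span {T}) (CharacterModule (τA.H n)) =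
      Module.finrank (Λ ⧸ Ideal.span {T}) (torsionBy Λ (CharacterModule (σA.H n)) T) :=
    fun n => finrank_characterModule_H_quotientRing_eq T σA τA hτA n
  -- rank of `D'`: `rank_{Λ/T} A^∨ = rank_{Λ/T} (D₀^∨/T D₀^∨) = rank_Λ D₀^∨` (`D₀^∨[T] = 0`)
  have hexact : Function.Exact A.subtype (T • (LinearMap.id : D₀ →ₗ[Λ] D₀)) := fun x => by
    constructor
    · intro hx
      exact ⟨⟨x, (mem_torsionBy_iff T x).2 hx⟩, rfl⟩
    · rintro ⟨a, rfl⟩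
      exact (mem_torsionBy_iff T (a : D₀)).1 a.2
  have hZ : ∀ χ : CharacterModule A, T • χ = 0 := fun χ => by
    ext a
    rw [CharacterModule.smul_apply, hA a, map_zero]
    rfl
  have hsurjA : Function.Surjective (CharacterModule.dual A.subtype) :=
    CharacterModule.dual_surjective_of_injective _ A.injective_subtype
  have hquotA : Module.finrank (Λ ⧸ Ideal.span {T}) (torsionBy Λ (CharacterModule A) T) =
      Module.finrank (Λ ⧸ Ideal.span {T})
        (CharacterModule D₀ ⧸ (Ideal.span {T} • ⊤ : Submodule Λ (CharacterModule D₀))) :=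
    finrank_torsionBy_eq_of_surjective T (CharacterModule.dual A.subtype) hZ
      (by simpa only [CharacterModule.dual_smul_id] using CharacterModule.exact_dual hexact) hsurjA
  have htors0 : Module.finrank (Λ ⧸ Ideal.span {T}) (torsionBy Λ (CharacterModule D₀) T) = 0 := by
    haveI : Subsingleton (torsionBy Λ (CharacterModule D₀) T) := by
      refine ⟨fun x y => Subtype.ext ?_⟩
      have hx := (mem_torsionBy_iff T (x : CharacterModule D₀)).mp x.2
      have hy := (mem_torsionBy_iff T (y : CharacterModule D₀)).mp y.2
      have key : ∀ χ : CharacterModule D₀, T • χ = 0 → χ = 0 := fun χ hχ => by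
        ext d
        obtain ⟨d', rfl⟩ := hdiv d
        have := DFunLike.congr_fun hχ d'
        rw [CharacterModule.smul_apply] at this
        exact this
      rw [key _ hx, key _ hy]
    exact finrank_zero_of_subsingleton
  have hF1 := finrank_eq_finrank_quotient_sub_finrank_torsionBy hT0 hTp (CharacterModule D₀)
  have hrkA : Module.finrank Λ (CharacterModule D₀) =
      Module.finrank (Λ ⧸ Ideal.span {T}) (CharacterModule A) := by
    rw [finrank_characterModule_quotientRing_eq (T := T) (M := A), hquotA]
    rw [htors0, Nat.cast_zero, sub_zero] at hF1
    exact_mod_cast hF1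
  -- `A^∨` is finitely generated over `Λ/T`
  haveI : IsScalarTower Λ (Λ ⧸ Ideal.span {T}) (CharacterModule A) :=
    IsScalarTower.of_algebraMap_smul fun r χ => by
      ext a
      rw [CharacterModule.smul_apply, CharacterModule.smul_apply, Ideal.Quotient.algebraMap_eq,
        torsionBy.mk_ideal_smul]
  have hfinA' : Module.Finite (Λ ⧸ Ideal.span {T}) (CharacterModule A) :=
    Module.Finite.of_restrictScalars_finite Λ (Λ ⧸ Ideal.span {T}) (CharacterModule A)
  -- assemble
  refine ⟨A, inferInstance, inferInstance, inferInstance, inferInstance, inferInstance, τA, hpA,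
    hfinA', ?_, hrkD.trans hrkA⟩
  rw [hrkH 0, hrkH 1, hrkH 2, hH 0, hH 1, hH 2]
  exact hengine.symm

end Step

end Literature.NumberTheory.IwasawaTheory.Greenberg2006

end
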